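import Literature.Geometry.Riemannian.GradientSolitonIdentities
import Mathlib.Topology.Order.Compact
import HarnessLib

/-!
# The minimum of `λ_min(Ric)/R` on a compact manifold with `R > 0`

The global step of the classification of compact shrinking Ricci solitons by the maximum principle
for `λ_min(Ric)/R` (Eminenti–La Nave–Mantegazza 2008, §3, p. 7: "Let now `λ_min : M → ℝ` be the
minimal eigenvalue of the Ricci tensor. If `p ∈ M` is the point where `λ_min/R` gets its minimum
with eigenvector `v_p` …"), in a definition-free form: on a compact manifold with a Riemannian
`C^∞` metric of positive scalar curvature there are a point `p` and a constant `m` with the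
**pinching** `Ric_x(w,w) ≥ m R(x) |w|²` everywhere and EQUALITY at some non-zero `w₀ ∈ T_pM`
(`exists_ricci_pinching_minimum`). The function `x ↦ inf_{w ≠ 0} Ric_x(w,w)/(R(x)|w|²)` is read in
charts as the infimum over the (compact) unit sphere of the model space of a jointly continuous
function of the chart components (`MetricCoord.ricAt`, `MetricCoord.scalAt`), hence is continuous
(`IsCompact.continuous_sInf`) and attains its minimum on the compact manifold; in each fibre the
infimum is attained by compactness of the sphere.

Everything is proved; no definitions are introduced.

## References

* M. Eminenti, G. La Nave, C. Mantegazza, *Ricci solitons: the equation point of view*,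
  manuscripta math. 127 (2008), §3 (p. 7). [EminentiLanaveMantegazza2008]
* B. O'Neill, *Semi-Riemannian geometry*, 1983, Ch. 3, Prop. 3.59 (tensors read in charts). [ONeill1983]
-/

noncomputable section

set_option maxSynthPendingDepth 3

open Bundle Set Function Filter Module Metric
open scoped Manifold ContDiff Topology

namespace Literature.Geometry.Riemannian

open Lorentzian Lorentzian.PseudoRiemannianMetric

variable {E : Type*} [NormedAddCommGroup E] [NormedSpace ℝ E] [FiniteDimensional ℝ E]
  {H : Type*} [TopologicalSpace H] {I : ModelWithCorners ℝ E H} [I.Boundaryless]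
  {M : Type*} [TopologicalSpace M] [ChartedSpace H M] [IsManifold I ∞ M]
  (g : PseudoRiemannianMetric I ∞ E (TangentSpace I : M → Type _)) [g.HasLeviCivita]

/-! ### The Rayleigh quotient read in a chart -/

/-- **The quotient `Ric(w,w)/(R|w|²)` read in the chart**: for `u` in the chart target at `x₀`,
`x = Φ(u)` and `w = dΦ_u ŵ`, it equals `ricAt G u (ŵ,ŵ)/(scalAt G u · G u (ŵ,ŵ))` for the chart
components `G`. [cite: ONeill1983, Ch. 3, Prop. 3.59] -/
theorem ricciQuot_chartInv_eq (x₀ : M) (u : chartTarget I x₀) (w : E) :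
    g.ricci (chartInv I x₀ u) (mfderiv 𝓘(ℝ, E) I (chartInv I x₀) u w)
        (mfderiv 𝓘(ℝ, E) I (chartInv I x₀) u w) /
      (g.scalarCurvature (chartInv I x₀ u) *
        g.val (chartInv I x₀ u) (mfderiv 𝓘(ℝ, E) I (chartInv I x₀) u w)
          (mfderiv 𝓘(ℝ, E) I (chartInv I x₀) u w)) =
    MetricCoord.ricAt (chartRep I (fun _ ↦ g) x₀ 0) u w w /
      (MetricCoord.scalAt (chartRep I (fun _ ↦ g) x₀ 0) u * chartRep I (fun _ ↦ g) x₀ 0 u w w) := by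
  haveI := (chartPullback I g x₀).hasLeviCivita
  have hG := val_chartPullback_eq_chartRep (fun _ : ℝ ↦ g) x₀ 0
  rw [← Lorentzian.OpensChart.ricci_eq_ricAt hG u, chartRep_apply, val_chartPullback_apply,
    g.ricci_comap_apply contMDiff_pullbackBilin_holds (contMDiff_chartInv x₀)
      (injective_mfderiv_chartInv x₀) rfl u,
    Lorentzian.scalarCurvature_chartInv_eq g x₀ u]

/-- The set of values of the quotient over non-zero tangent vectors at `Φ(u)` is the set of values
of the chart quotient over non-zero model vectors (`dΦ_u` is a linear isomorphism). [folklore] -/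
theorem ricciQuot_image_chartInv_eq (x₀ : M) (u : chartTarget I x₀) :
    (fun w : TangentSpace I (chartInv I x₀ u) ↦ g.ricci (chartInv I x₀ u) w w /
        (g.scalarCurvature (chartInv I x₀ u) * g.val (chartInv I x₀ u) w w)) '' {w | w ≠ 0} =
      (fun w : E ↦ MetricCoord.ricAt (chartRep I (fun _ ↦ g) x₀ 0) u w w /
        (MetricCoord.scalAt (chartRep I (fun _ ↦ g) x₀ 0) u *
          chartRep I (fun _ ↦ g) x₀ 0 u w w)) '' {w | w ≠ 0} := by
  have hinj := injective_mfderiv_chartInv (I := I) x₀ u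
  have hinv := isInvertible_mfderiv_of_injective rfl hinj
  set L := mfderiv 𝓘(ℝ, E) I (chartInv I x₀) u with hL
  ext r
  constructor
  · rintro ⟨w, hw, rfl⟩
    obtain ⟨v, rfl⟩ : ∃ v : E, L v = w :=
      ⟨L.inverse w, by rw [← ContinuousLinearMap.comp_apply, hinv.self_comp_inverse]; rfl⟩
    refine ⟨v, fun hv ↦ hw (by subst hv; exact map_zero L), ?_⟩
    exact (ricciQuot_chartInv_eq g x₀ u v).symm
  · rintro ⟨v, hv, rfl⟩
    refine ⟨L v, fun h0 ↦ hv (hinj (h0.trans (map_zero L).symm)), ?_⟩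
    exact ricciQuot_chartInv_eq g x₀ u v

/-! ### The chart quotient: homogeneity, fibre minima, continuity -/

section Chart

variable {G : E → E →L[ℝ] E →L[ℝ] ℝ} {T : Set E}

/-- Homogeneity: over non-zero vectors the chart quotient takes the same values as over the unit
sphere. [folklore] -/
theorem MetricCoordAux.quot_image_ne_zero_eq_image_sphere (y : E) :
    (fun w : E ↦ MetricCoord.ricAt G y w w / (MetricCoord.scalAt G y * G y w w)) '' {w | w ≠ 0} =
      (fun w : E ↦ MetricCoord.ricAt G y w w / (MetricCoord.scalAt G y * G y w w)) ''
        sphere (0 : E) 1 := by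
  ext r
  constructor
  · rintro ⟨w, hw, rfl⟩
    have hn : 0 < ‖w‖ := norm_pos_iff.mpr hw
    refine ⟨‖w‖⁻¹ • w, by simp [norm_smul, inv_mul_cancel₀ hn.ne'], ?_⟩
    simp only [map_smul, FunLike.coe_smul, Pi.smul_apply, smul_eq_mul]
    have hc : (‖w‖⁻¹ : ℝ) ≠ 0 := inv_ne_zero hn.ne'
    by_cases hden : MetricCoord.scalAt G y * G y w w = 0
    · rcases mul_eq_zero.mp hden with h | h
      · simp [h]
      · simp [h]
    · field_simp
  · rintro ⟨w, hw, rfl⟩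
    have hw0 : w ≠ 0 := by
      rintro rfl
      simp at hw
    exact ⟨w, hw0, rfl⟩

/-- **Fibre minima of the chart quotient**: on the chart target (where `G` is positive definite
and `scalAt G > 0`) the set of values over the unit sphere is compact, and non-empty when the
model space is non-trivial. [folklore] -/
theorem MetricCoordAux.isCompact_quot_image_sphere {y : E}
    (hpos : ∀ w : E, w ≠ 0 → 0 < G y w w) (hS : 0 < MetricCoord.scalAt G y) :
    IsCompact ((fun w : E ↦ MetricCoord.ricAt G y w w / (MetricCoord.scalAt G y * G y w w)) ''
      sphere (0 : E) 1) := by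
  refine (isCompact_sphere (0 : E) 1).image_of_continuousOn ?_
  have hc1 : Continuous fun w : E ↦ MetricCoord.ricAt G y w w :=
    (MetricCoord.ricAt G y).continuous.clm_apply continuous_id
  have hc2 : Continuous fun w : E ↦ G y w w := (G y).continuous.clm_apply continuous_id
  refine ContinuousOn.div hc1.continuousOn (continuous_const.mul hc2).continuousOn fun w hw ↦ ?_
  have hw0 : w ≠ 0 := by rintro rfl; simp at hw
  exact mul_ne_zero hS.ne' (hpos w hw0).ne'

/-- **Continuity of the fibre infimum of the chart quotient** on an open set where `G` is positive
definite and `scalAt G > 0` (`IsCompact.continuous_sInf` on the unit sphere). [folklore] -/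
theorem MetricCoordAux.continuousOn_sInf_quot (hGm : MetricCoord.IsMetricOn G T)
    (hpos : ∀ y ∈ T, ∀ w : E, w ≠ 0 → 0 < G y w w) (hS : ∀ y ∈ T, 0 < MetricCoord.scalAt G y) :
    ContinuousOn (fun y ↦ sInf ((fun w : E ↦ MetricCoord.ricAt G y w w /
      (MetricCoord.scalAt G y * G y w w)) '' sphere (0 : E) 1)) T := by
  -- jointly continuous quotient on `T × sphere`
  set f : T → sphere (0 : E) 1 → ℝ := fun y w ↦ MetricCoord.ricAt G y (w : E) (w : E) /
    (MetricCoord.scalAt G y * G y (w : E) (w : E)) with hf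
  have hR : Continuous fun p : T × sphere (0 : E) 1 ↦ MetricCoord.ricAt G p.1 (p.2 : E) (p.2 : E) := by
    have h1 : Continuous fun p : T × sphere (0 : E) 1 ↦ MetricCoord.ricAt G p.1 :=
      hGm.contDiffOn_ricAt.continuousOn.comp_continuous (continuous_subtype_val.comp continuous_fst)
        fun p ↦ p.1.2
    have h2 : Continuous fun p : T × sphere (0 : E) 1 ↦ ((p.2 : sphere (0 : E) 1) : E) :=
      continuous_subtype_val.comp continuous_snd
    exact (h1.clm_apply h2).clm_apply h2
  have hGc : Continuous fun p : T × sphere (0 : E) 1 ↦ G p.1 (p.2 : E) (p.2 : E) := by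
    have h1 : Continuous fun p : T × sphere (0 : E) 1 ↦ G p.1 :=
      hGm.contDiffOn.continuousOn.comp_continuous (continuous_subtype_val.comp continuous_fst)
        fun p ↦ p.1.2
    have h2 : Continuous fun p : T × sphere (0 : E) 1 ↦ ((p.2 : sphere (0 : E) 1) : E) :=
      continuous_subtype_val.comp continuous_snd
    exact (h1.clm_apply h2).clm_apply h2
  have hSc : Continuous fun p : T × sphere (0 : E) 1 ↦ MetricCoord.scalAt G p.1 :=
    hGm.contDiffOn_scalAt.continuousOn.comp_continuous (continuous_subtype_val.comp continuous_fst)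
      fun p ↦ p.1.2
  have hfc : Continuous ↿f := by
    refine Continuous.div hR (hSc.mul hGc) fun p ↦ ?_
    have hw0 : (p.2 : E) ≠ 0 := by
      intro h
      have := p.2.2
      rw [mem_sphere_zero_iff_norm, h, norm_zero] at this
      exact zero_ne_one this
    exact mul_ne_zero (hS _ p.1.2).ne' (hpos _ p.1.2 _ hw0).ne'
  have hcont : Continuous fun y : T ↦ sInf (f y '' univ) :=
    isCompact_univ.continuous_sInf hfc
  rw [continuousOn_iff_continuous_restrict]
  refine hcont.congr fun y ↦ ?_
  simp only [restrict_apply, hf, image_univ]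
  congr 1
  ext r
  simp only [mem_range, mem_image, Subtype.exists, exists_prop]

end Chart

/-! ### The pinching minimum -/

/-- **The minimum of `λ_min(Ric)/R`** (Eminenti–La Nave–Mantegazza 2008, §3, p. 7), definition-free:
on a compact manifold with a Riemannian `C^∞` metric of positive scalar curvature (model space of
positive dimension) there are `p ∈ M` and `m ∈ ℝ` with `Ric_x(w,w) ≥ m R(x) g_x(w,w)` for all `x, w`
and `Ric_p(w₀,w₀) = m R(p) g_p(w₀,w₀)` for some `w₀ ≠ 0`.
[cite: EminentiLanaveMantegazza2008, §3 (p. 7)] -/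
theorem exists_ricci_pinching_minimum [CompactSpace M] [Nonempty M] (hg : g.IsRiemannian)
    (hS : ∀ x, 0 < g.scalarCurvature x) (hE : 0 < finrank ℝ E) :
    ∃ (p : M) (m : ℝ),
      (∀ (x : M) (w : TangentSpace I x), m * g.scalarCurvature x * g.val x w w ≤ g.ricci x w w) ∧
      ∃ w₀ : TangentSpace I p, w₀ ≠ 0 ∧
        g.ricci p w₀ w₀ = m * g.scalarCurvature p * g.val p w₀ w₀ := by
  -- the fibre infimum
  set ψ : M → ℝ := fun x ↦ sInf ((fun w : TangentSpace I x ↦ g.ricci x w w /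
    (g.scalarCurvature x * g.val x w w)) '' {w | w ≠ 0}) with hψ
  -- a unit vector of the model space
  have hsph : (sphere (0 : E) 1).Nonempty := by
    obtain ⟨w, hw⟩ := (Module.finrank_pos_iff_exists_ne_zero (R := ℝ) (M := E)).mp hE
    have hn : 0 < ‖w‖ := norm_pos_iff.mpr hw
    exact ⟨‖w‖⁻¹ • w, by simp [norm_smul, inv_mul_cancel₀ hn.ne']⟩
  -- chart data at a point
  have hchart : ∀ x₀ : M,
      let G := chartRep I (fun _ ↦ g) x₀ 0
      MetricCoord.IsMetricOn G (extChartAt I x₀).target ∧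
        (∀ y ∈ (extChartAt I x₀).target, ∀ w : E, w ≠ 0 → 0 < G y w w) ∧
        (∀ y ∈ (extChartAt I x₀).target, 0 < MetricCoord.scalAt G y) := by
    intro x₀ G
    refine ⟨Lorentzian.OpensChart.isMetricOn_repr (val_chartPullback_eq_chartRep (fun _ : ℝ ↦ g) x₀ 0),
      fun y hy w hw ↦ ?_, fun y hy ↦ ?_⟩
    · rw [show y = ((⟨y, hy⟩ : chartTarget I x₀) : E) from rfl, chartRep_apply]
      exact chartPullback_pos g x₀ ⟨y, hy⟩ (fun w' hw' ↦ hg _ w' hw') w hw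
    · rw [← Lorentzian.scalarCurvature_chartInv_eq g x₀ ⟨y, hy⟩]
      exact hS _
  -- `ψ` read in the chart at `x₀`: `ψ x = Ψ̂(φ x)` on the chart source
  have hψchart : ∀ (x₀ x : M), x ∈ (extChartAt I x₀).source →
      ψ x = sInf ((fun w : E ↦ MetricCoord.ricAt (chartRep I (fun _ ↦ g) x₀ 0) (extChartAt I x₀ x) w w /
        (MetricCoord.scalAt (chartRep I (fun _ ↦ g) x₀ 0) (extChartAt I x₀ x) *
          chartRep I (fun _ ↦ g) x₀ 0 (extChartAt I x₀ x) w w)) '' sphere (0 : E) 1) := by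
    intro x₀ x hx
    have hu : extChartAt I x₀ x ∈ (extChartAt I x₀).target := (extChartAt I x₀).map_source hx
    set u : chartTarget I x₀ := ⟨extChartAt I x₀ x, hu⟩
    have hxu : chartInv I x₀ u = x := (extChartAt I x₀).left_inv hx
    rw [← MetricCoordAux.quot_image_ne_zero_eq_image_sphere,
      show (extChartAt I x₀ x) = (u : E) from rfl, ← ricciQuot_image_chartInv_eq g x₀ u]
    simp only [hψ]
    rw [hxu]
  -- continuity of `ψ`
  have hψc : Continuous ψ := by
    rw [continuous_iff_continuousAt]
    intro x₀
    obtain ⟨hGm, hpos, hSpos⟩ := hchart x₀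
    have hΨ := MetricCoordAux.continuousOn_sInf_quot hGm hpos hSpos
    have hev : ψ =ᶠ[𝓝 x₀] fun x ↦ sInf ((fun w : E ↦
        MetricCoord.ricAt (chartRep I (fun _ ↦ g) x₀ 0) (extChartAt I x₀ x) w w /
        (MetricCoord.scalAt (chartRep I (fun _ ↦ g) x₀ 0) (extChartAt I x₀ x) *
          chartRep I (fun _ ↦ g) x₀ 0 (extChartAt I x₀ x) w w)) '' sphere (0 : E) 1) := by
      filter_upwards [extChartAt_source_mem_nhds (I := I) x₀] with x hx using hψchart x₀ x hx
    refine (ContinuousAt.congr ?_ hev.symm)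
    exact (hΨ.continuousAt ((isOpen_extChartAt_target x₀).mem_nhds (mem_extChartAt_target x₀))).comp
      (continuousAt_extChartAt x₀)
  -- the minimum point
  obtain ⟨p, -, hp⟩ := isCompact_univ.exists_isMinOn univ_nonempty hψc.continuousOn
  refine ⟨p, ψ p, fun x w ↦ ?_, ?_⟩
  · -- pinching everywhere
    by_cases hw : w = 0
    · subst hw; simp
    · obtain ⟨hGm, hpos, hSpos⟩ := hchart x
      have hxs : x ∈ (extChartAt I x).source := mem_extChartAt_source x
      have hu : extChartAt I x x ∈ (extChartAt I x).target := mem_extChartAt_target x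
      -- `ψ x ≤` the quotient at `w`
      have hle : ψ x ≤ g.ricci x w w / (g.scalarCurvature x * g.val x w w) := by
        have hmem : g.ricci x w w / (g.scalarCurvature x * g.val x w w) ∈
            (fun w : TangentSpace I x ↦ g.ricci x w w / (g.scalarCurvature x * g.val x w w)) ''
              {w | w ≠ 0} := ⟨w, hw, rfl⟩
        have hbdd : BddBelow ((fun w : TangentSpace I x ↦ g.ricci x w w /
            (g.scalarCurvature x * g.val x w w)) '' {w | w ≠ 0}) := by
          set u : chartTarget I x := ⟨extChartAt I x x, hu⟩
          have hxu : chartInv I x u = x := extChartAt_to_inv x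
          have himg := ricciQuot_image_chartInv_eq g x u
          rw [hxu] at himg
          rw [himg, MetricCoordAux.quot_image_ne_zero_eq_image_sphere]
          exact (MetricCoordAux.isCompact_quot_image_sphere (hpos _ hu) (hSpos _ hu)).bddBelow
        exact csInf_le hbdd hmem
      have hmin : ψ p ≤ ψ x := hp (mem_univ x)
      have hden : 0 < g.scalarCurvature x * g.val x w w := mul_pos (hS x) (hg x w hw)
      have h := (le_div_iff₀ hden).mp (hmin.trans hle)
      linarith [h]
  · -- the infimum at `p` is attained
    obtain ⟨hGm, hpos, hSpos⟩ := hchart p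
    have hu : extChartAt I p p ∈ (extChartAt I p).target := mem_extChartAt_target p
    set u : chartTarget I p := ⟨extChartAt I p p, hu⟩
    have hxu : chartInv I p u = p := extChartAt_to_inv p
    have himg := ricciQuot_image_chartInv_eq g p u
    rw [hxu] at himg
    have hcpt := MetricCoordAux.isCompact_quot_image_sphere (hpos _ hu) (hSpos _ hu)
    have hne : ((fun w : E ↦ MetricCoord.ricAt (chartRep I (fun _ ↦ g) p 0) u w w /
        (MetricCoord.scalAt (chartRep I (fun _ ↦ g) p 0) u * chartRep I (fun _ ↦ g) p 0 u w w)) ''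
          sphere (0 : E) 1).Nonempty := hsph.image _
    have hmem := hcpt.sInf_mem hne
    rw [← MetricCoordAux.quot_image_ne_zero_eq_image_sphere, ← himg] at hmem
    obtain ⟨w₀, hw₀, hval⟩ := hmem
    refine ⟨w₀, hw₀, ?_⟩
    have hden : 0 < g.scalarCurvature p * g.val p w₀ w₀ := mul_pos (hS p) (hg p w₀ hw₀)
    have hψp : ψ p = g.ricci p w₀ w₀ / (g.scalarCurvature p * g.val p w₀ w₀) := by
      rw [hψ]; exact hval.symm
    have h1 : g.scalarCurvature p ≠ 0 := (hS p).ne'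
    have h2 : g.val p w₀ w₀ ≠ 0 := (hg p w₀ hw₀).ne'
    rw [hψp]
    field_simp

end Literature.Geometry.Riemannian

end
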